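import Literature.AlgebraicGeometry.HodgeTheory.CartierTwistTower
import Literature.AlgebraicGeometry.HodgeTheory.BertiniPencilAnalytic
import Literature.AlgebraicGeometry.HodgeTheory.SerreTheoremALineBundlesProofs
import Literature.AlgebraicGeometry.HodgeTheory.RationalHodgeClasses
import Literature.Geometry.Kaehler.HolomorphicLineBundleCechPencil
import Literature.Geometry.Kaehler.HolomorphicLineBundleCechFiniteAll
import Literature.Geometry.Kaehler.HolomorphicLineBundleCechLerayData
import Literature.Geometry.Kaehler.TransversalNullstellensatzChart
import Literature.Geometry.Kaehler.HolomorphicInterpolation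
import HarnessLib

/-!
# Serre's théorème A for line cocycles on a projective surface through `TwistPencil`

Layer `Literature/AlgebraicGeometry/HodgeTheory`. J.-P. Serre, *Géométrie algébrique et géométrie
analytique* (1956), n° 16 Lemme 8, for the sheaf of sections of a holomorphic line cocycle `L` on
an analytification `φ : M → X(ℂ)` of a smooth projective SURFACE `X`: some twist
`L ⊗ 𝒪_X((m+1)H)^an` by a hyperplane section `H` has a holomorphic section which is not identically
zero. The proof is the Euler-characteristic count with no vanishing theorem, no duality and no
GAGA, assembled from the tree:

* the transverse pencil `H`, `s₀ = 1`, `s₁` of Bertini (`exists_transverse_flag`, algebraic side read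
  on `M`: jointly surjective differentials along the flag, finite non-empty common zero set `Z`,
  dense non-vanishing loci);
* the tower `L_m = L ⊗ 𝒪_X(mH)^an` and the multiplications by `s₀, s₁`
  (`CartierTwistTower`: `twistBundle`, `homSectionOfIsSection`);
* nested Leray data subordinate to the (common) trivialisation of the tower
  (`HolomorphicLineBundle.exists_dolbeaultLerayDatum_subordinate`) and the Cartan–Serre finiteness of
  `Ȟ^q(𝔘₀, 𝒪(L_m))` in every degree (`DolbeaultLerayDatum.finiteDimensional_cohomologyL`);
* the memberwise local algebra on the chart-convex finite intersections of the level-`0` cover: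
  `(s₀, s₁)` is a regular pair (`exists_mdifferentiableOn_eq_mul_of_mul_eq_mul_chartSet`),
  interpolation at `Z` (`exists_mdifferentiableOn_chartSet_forall_eq`), and the transversal
  Nullstellensatz `HasTransversalNullstellensatz` (`hasTransversalNullstellensatz_of_finrank_eq_two`);
* the count itself (`HolomorphicLineBundle.TwistPencil.exists_h0_pos`, from
  `NatCochain.PencilTower`).

Results:

* `exists_h0_twistBundle_pos` — for `φ : M → X(ℂ)` an analytification of a smooth projective
  surface, `M` compact, and `(E, M)` with the transversal Nullstellensatz, every cocycle line bundle
  `L` on `M` has a hyperplane-section divisor `H` (with its section `1`) such that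
  `h⁰(M, L ⊗ 𝒪_X((m+1)H)^an) > 0` for some `m`;
* `serre_theoremA_lineCocycle_surface_of_hasTransversalNullstellensatz` — hence the named fact
  `serre_theoremA_lineCocycle_surface` (on Hodge models), given the transversal Nullstellensatz in
  dimension `2`, which the tree proves (`hasTransversalNullstellensatz_of_finrank_eq_two`).

The discharge `serre_theoremA_lineCocycle_surface_holds` itself lives in the sibling file
`SerreTheoremALineBundlesProofs` (a hand-built tower on the same bricks, landed first); this file is
the assembly through the reusable packages `NatCochain.PencilTower` / `HolomorphicLineBundle.TwistPencil`
and records the general-carrier `h⁰` form. Everything is proved; no definitions.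

## References

* J.-P. Serre, *Géométrie algébrique et géométrie analytique*, Ann. Inst. Fourier 6 (1956), n° 16
  Lemme 8, n° 16–17 Théorèmes A–B. [SerreGAGA1956]
* U. Görtz, T. Wedhorn, *Algebraic Geometry I*, 2nd ed. (2020), (11.9). [GortzWedhorn2020]
-/

noncomputable section

open scoped Manifold ContDiff Topology
open Set Filter Function AlgebraicGeometry
open Literature.AlgebraicGeometry.Motives
open Literature.AlgebraicGeometry.Motives.RatFn
open Literature.NumberTheory.Transcendental
open Literature.Geometry.Kaehler

namespace Literature.AlgebraicGeometry.HodgeTheory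

/-! ### A small manifold helper -/

section Helpers

variable {E : Type*} [NormedAddCommGroup E] [NormedSpace ℂ E]
  {M : Type*} [TopologicalSpace M] [ChartedSpace E M]

/-- A function holomorphic on `W` defines an element of `𝒪(W)` (extended by zero) agreeing with it on
`W`. [folklore] -/
theorem holFunOn_exists_forall_eq {W : Set M} {f : M → ℂ}
    (hf : MDifferentiableOn 𝓘(ℂ, E) 𝓘(ℂ, ℂ) f W) :
    ∃ F : holFunOn E W, ∀ x ∈ W, (F : M → ℂ) x = f x :=
  ⟨⟨W.indicator f, hf.congr fun _ hx ↦ indicator_of_mem hx f, fun _ hx ↦ indicator_of_notMem hx f⟩,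
    fun _ hx ↦ indicator_of_mem hx f⟩

end Helpers

/-! ### The dimension count on an analytification of a smooth projective surface -/

section Count

variable {X : SchemeOver ℂ} [IsIntegral X.left]
  {E : Type} [NormedAddCommGroup E] [NormedSpace ℂ E] [FiniteDimensional ℂ E]
  {M : Type} [TopologicalSpace M] [ChartedSpace E M] [IsManifold 𝓘(ℂ, E) ω M]
  [IsManifold 𝓘(ℝ, E) ∞ M] [T2Space M] [CompactSpace M]
  {φ : M → ComplexPoints X}

/-- **Serre's Lemme 8 for line cocycles on a surface, `h⁰` form.** For `X` a smooth projective
surface over `ℂ`, `φ : M → X(ℂ)` an analytification with `M` compact, `(E, M)` satisfying the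
transversal Nullstellensatz on chart sets, and `L` a cocycle line bundle on `M`: there is a Cartier
divisor `H` on `X` with `1 ∈ Γ(X, 𝒪_X(H))` (a hyperplane section) such that
`h⁰(M, L ⊗ 𝒪_X((m+1) • H)^an) > 0` for some `m`. Proof: Bertini pencil + one framed cover of the
tower from nested Leray data + the memberwise local algebra + `TwistPencil.exists_h0_pos` with the
Cartan–Serre finiteness of every `Ȟ^q`. [cite: SerreGAGA1956, n° 16 Lemme 8] -/
theorem exists_h0_twistBundle_pos (hX : IsSmoothProjective 2 X) (hφ : IsAnalytification E X 2 φ)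
    (hN : HasTransversalNullstellensatz E M) {ι : Type*} (L : HolomorphicLineBundle ι E M) :
    ∃ H : CartierDivisor X.left, H.IsSection 1 ∧ ∃ m : ℕ, 0 < (twistBundle hφ H L (m + 1)).h0 := by
  classical
  -- the Bertini pencil
  obtain ⟨H, s, hs, hs0, hflag, hfin, hne, hdense⟩ := exists_transverse_flag hX two_pos hφ
  -- notation: the coordinates of the two sections
  set u : Fin 2 → H.ι → M → ℂ := fun j a ↦ H.sectionCoord φ (hs j) a with hu
  set Z : Set M := {m : M | ∃ a : H.ι, (φ m).pt ∈ H.U a ∧ ∀ j, H.sectionCoord φ (hs j) a m = 0}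
    with hZ
  -- nested Leray data subordinate to the common trivialisation of the tower
  let 𝒲 : Literature.Geometry.Manifold.OpenNhdFamily M :=
    ⟨fun _ ↦ univ, fun _ ↦ isOpen_univ, fun _ ↦ mem_univ _⟩
  obtain ⟨D, fr, hfr, -⟩ := (twistBundle hφ H L 0).exists_dolbeaultLerayDatum_subordinate 𝒲
  have hfrm : ∀ (m : ℕ) (i : ↥D.s), D.U 3 i ⊆ (twistBundle hφ H L m).baseSet (fr i) :=
    fun m i ↦ hfr i
  have hU3 : ∀ k : ↥D.s, D.U 0 k ⊆ D.U 3 k := fun k ↦ D.mono 0 3 (Fin.le_last _) k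
  have hUa : ∀ (k : ↥D.s) (x : M), x ∈ D.U 0 k → (φ x).pt ∈ H.U (fr k).2 :=
    fun k x hx ↦ (hfr k (hU3 k hx)).2
  have hWa : ∀ {a : ℕ} (J : Fin (a + 1) → ↥D.s) (x : M), x ∈ cechSet (D.U 0) J →
      (φ x).pt ∈ H.U (fr (J 0)).2 := by
    intro a J x hx
    exact hUa (J 0) x (cechSet_subset_apply _ J 0 hx)
  -- the coordinates are holomorphic on the members
  have hol : ∀ (j : Fin 2) {a : ℕ} (J : Fin (a + 1) → ↥D.s),
      MDifferentiableOn 𝓘(ℂ, E) 𝓘(ℂ, ℂ) (u j (fr (J 0)).2) (cechSet (D.U 0) J) := by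
    intro j a J
    exact (mdifferentiableOn_sectionCoord hφ (hs j) (fr (J 0)).2).mono fun x hx ↦ hWa J x hx
  -- the transversality conditions read on the members
  have hd₁ : ∀ {a : ℕ} (J : Fin (a + 1) → ↥D.s), ∀ x ∈ cechSet (D.U 0) J, u 0 (fr (J 0)).2 x = 0 →
      mfderiv 𝓘(ℂ, E) 𝓘(ℂ, ℂ) (u 0 (fr (J 0)).2) x ≠ 0 := by
    intro a J x hx h0
    have hsurj := hflag (fr (J 0)).2 x 1 one_le_two (hWa J x hx) (fun i ↦ by
      fin_cases i
      exact h0)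
    exact ne_zero_of_surjective_pi_fin_one hsurj
  have hd₁₂ : ∀ {a : ℕ} (J : Fin (a + 1) → ↥D.s), ∀ x ∈ cechSet (D.U 0) J, u 0 (fr (J 0)).2 x = 0 →
      u 1 (fr (J 0)).2 x = 0 →
      Surjective (ContinuousLinearMap.pi fun i : Fin 2 ↦
        (![mfderiv 𝓘(ℂ, E) 𝓘(ℂ, ℂ) (u 0 (fr (J 0)).2) x,
          mfderiv 𝓘(ℂ, E) 𝓘(ℂ, ℂ) (u 1 (fr (J 0)).2) x] i)) := by
    intro a J x hx h0 h1
    have hsurj := hflag (fr (J 0)).2 x 2 le_rfl (hWa J x hx) (fun i ↦ by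
      fin_cases i
      · exact h0
      · exact h1)
    have e : (fun i : Fin 2 ↦ (![mfderiv 𝓘(ℂ, E) 𝓘(ℂ, ℂ) (u 0 (fr (J 0)).2) x,
        mfderiv 𝓘(ℂ, E) 𝓘(ℂ, ℂ) (u 1 (fr (J 0)).2) x] i)) =
        fun i : Fin 2 ↦ mfderiv 𝓘(ℂ, E) 𝓘(ℂ, ℂ)
          (H.sectionCoord φ (hs (Fin.castLE le_rfl i)) (fr (J 0)).2) x := by
      funext i
      fin_cases i <;> rfl
    rw [e]
    exact hsurj
  have hind : ∀ {a : ℕ} (J : Fin (a + 1) → ↥D.s), ∀ x ∈ cechSet (D.U 0) J, u 0 (fr (J 0)).2 x = 0 →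
      u 1 (fr (J 0)).2 x = 0 → ∀ c : ℂ, mfderiv 𝓘(ℂ, E) 𝓘(ℂ, ℂ) (u 1 (fr (J 0)).2) x ≠
        c • mfderiv 𝓘(ℂ, E) 𝓘(ℂ, ℂ) (u 0 (fr (J 0)).2) x := by
    intro a J x hx h0 h1 c hc
    exact not_surjective_pi_of_eq_smul hc (hd₁₂ J x hx h0 h1)
  -- points of the members where both coordinates vanish are in `Z`, and conversely
  have hmemZ : ∀ {a : ℕ} (J : Fin (a + 1) → ↥D.s), ∀ x ∈ cechSet (D.U 0) J, u 0 (fr (J 0)).2 x = 0 →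
      u 1 (fr (J 0)).2 x = 0 → x ∈ Z := by
    intro a J x hx h0 h1
    refine ⟨(fr (J 0)).2, hWa J x hx, fun j ↦ ?_⟩
    fin_cases j
    · exact h0
    · exact h1
  have hZero : ∀ (j : Fin 2) (k : ↥D.s), ∀ x ∈ Z ∩ D.U 0 k, u j (fr k).2 x = 0 := by
    rintro j k x ⟨⟨a, ha, hza⟩, hxk⟩
    change H.sectionCoord φ (hs j) (fr k).2 x = 0
    rw [sectionCoord_eq_mul (hs j) ha (hUa k x hxk), hza j, mul_zero]
  -- the twist pencil on the level-`0` cover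
  let T : HolomorphicLineBundle.TwistPencil (ι × H.ι) ↥D.s E M :=
    { L := fun m ↦ twistBundle hφ H L m
      t := fun m ↦ homSectionOfIsSection hφ H L (hs 0) m
      t' := fun m ↦ homSectionOfIsSection hφ H L (hs 1) m
      U := D.U 0
      isOpen := D.isOpen 0
      frame := fr
      subset := fun m k ↦ (hU3 k).trans (hfrm m k)
      Z := Z
      coord_comm := fun m i y _ ↦ by
        simp only [homSectionOfIsSection_coord]
        exact mul_comm _ _
      dense := fun m a J ↦
        cechSet_subset_closure_coord_ne_zero hφ H L (hs 0) (D.framedCover fr (hfrm m) 0) (hdense 0) J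
      regular := by
        intro m a J f g hfg
        have hW := D.cechSet_eq a J 0
        have hWm : ∀ x, x ∈ chartSet 𝓘(ℝ, E) (D.ctr a J) (D.C a J 0) ↔ x ∈ cechSet (D.U 0) J :=
          fun x ↦ by rw [hW]
        have ht₁ : MDifferentiableOn 𝓘(ℂ, E) 𝓘(ℂ, ℂ) (u 0 (fr (J 0)).2)
            (chartSet 𝓘(ℝ, E) (D.ctr a J) (D.C a J 0)) := by rw [← hW]; exact hol 0 J
        have ht₂ : MDifferentiableOn 𝓘(ℂ, E) 𝓘(ℂ, ℂ) (u 1 (fr (J 0)).2)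
            (chartSet 𝓘(ℝ, E) (D.ctr a J) (D.C a J 0)) := by rw [← hW]; exact hol 1 J
        have hf : MDifferentiableOn 𝓘(ℂ, E) 𝓘(ℂ, ℂ) (f : M → ℂ)
            (chartSet 𝓘(ℝ, E) (D.ctr a J) (D.C a J 0)) := by
          rw [← hW]; exact holFunOn.mdifferentiableOn f
        obtain ⟨h, hh, hfh⟩ := exists_mdifferentiableOn_eq_mul_of_mul_eq_mul_chartSet (D.ctr a J)
          (D.C_open a J 0) (D.C_subset a J 0) ht₁ ht₂ hf (fun x hx ↦ hd₁ J x ((hWm x).1 hx))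
          (fun x hx ↦ hind J x ((hWm x).1 hx)) (g := (g : M → ℂ))
          (fun x hx ↦ hfg x ((hWm x).1 hx))
        rw [← hW] at hh
        obtain ⟨F, hF⟩ := holFunOn_exists_forall_eq hh
        exact ⟨F, fun x hx ↦ by rw [hF x hx]; exact hfh x ((hWm x).2 hx)⟩
      decompose := by
        intro m a J f hfZ
        have hW := D.cechSet_eq a J 0
        have hWm : ∀ x, x ∈ chartSet 𝓘(ℝ, E) (D.ctr a J) (D.C a J 0) ↔ x ∈ cechSet (D.U 0) J :=
          fun x ↦ by rw [hW]
        have ht₁ : MDifferentiableOn 𝓘(ℂ, E) 𝓘(ℂ, ℂ) (u 0 (fr (J 0)).2)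
            (chartSet 𝓘(ℝ, E) (D.ctr a J) (D.C a J 0)) := by rw [← hW]; exact hol 0 J
        have ht₂ : MDifferentiableOn 𝓘(ℂ, E) 𝓘(ℂ, ℂ) (u 1 (fr (J 0)).2)
            (chartSet 𝓘(ℝ, E) (D.ctr a J) (D.C a J 0)) := by rw [← hW]; exact hol 1 J
        have hf : MDifferentiableOn 𝓘(ℂ, E) 𝓘(ℂ, ℂ) (f : M → ℂ)
            (chartSet 𝓘(ℝ, E) (D.ctr a J) (D.C a J 0)) := by
          rw [← hW]; exact holFunOn.mdifferentiableOn f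
        have hz : ∀ x ∈ chartSet 𝓘(ℝ, E) (D.ctr a J) (D.C a J 0), u 0 (fr (J 0)).2 x = 0 →
            u 1 (fr (J 0)).2 x = 0 → (f : M → ℂ) x = 0 := fun x hx h0 h1 ↦
          hfZ x ⟨hmemZ J x ((hWm x).1 hx) h0 h1, (hWm x).1 hx⟩
        obtain ⟨g, h, hg, hh, hfgh⟩ := hN (D.ctr a J) (D.C_open a J 0) (D.C_convex a J 0)
          (D.C_subset a J 0) ht₁ ht₂ hf (fun x hx ↦ hd₁ J x ((hWm x).1 hx))
          (fun x hx ↦ hd₁₂ J x ((hWm x).1 hx)) hz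
        rw [← hW] at hg hh
        obtain ⟨G, hG⟩ := holFunOn_exists_forall_eq hg
        obtain ⟨G', hG'⟩ := holFunOn_exists_forall_eq hh
        exact ⟨G, G', fun x hx ↦ by rw [hG x hx, hG' x hx]; exact hfgh x ((hWm x).2 hx)⟩
      coord_eq_zero := fun m k x hx ↦ ⟨hZero 0 k x hx, hZero 1 k x hx⟩
      interpolate := by
        intro a J v
        have hW := D.cechSet_eq a J 0
        have hZW : (Z ∩ cechSet (D.U 0) J).Finite := hfin.inter_of_left _
        obtain ⟨f, hf, hfv⟩ := exists_mdifferentiableOn_chartSet_forall_eq (D.ctr a J)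
          (C := D.C a J 0) hZW.toFinset (fun z hz ↦ by
            rw [← hW]
            exact ((Finite.mem_toFinset hZW).1 hz).2) v
        rw [← hW] at hf
        obtain ⟨F, hF⟩ := holFunOn_exists_forall_eq hf
        exact ⟨F, fun x hx ↦ by rw [hF x hx.2]; exact hfv x ((Finite.mem_toFinset hZW).2 hx)⟩
      finite_Z := hfin
      meets := by
        obtain ⟨z, hz⟩ := hne
        have hzU : z ∈ ⋃ i, D.U 0 i := by rw [D.cover 0]; exact mem_univ z
        obtain ⟨k, hk⟩ := mem_iUnion.1 hzU
        exact ⟨z, hz, k, hk⟩ }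
  -- the count
  obtain ⟨z, -, k₀, -⟩ := T.meets
  haveI : Nonempty ↥D.s := ⟨k₀⟩
  have hfinL : ∀ m q, FiniteDimensional ℂ ((T.cover m).cohomology q) := fun m q ↦
    D.finiteDimensional_cohomologyL fr (hfrm m) q
  have hcov : ∀ x : M, ∃ k, x ∈ T.U k := fun x ↦ by
    have hxU : x ∈ ⋃ i, D.U 0 i := by rw [D.cover 0]; exact mem_univ x
    exact mem_iUnion.1 hxU
  obtain ⟨m, hm⟩ := T.exists_h0_pos hfinL hcov
  have h1 : H.IsSection 1 := hs0 ▸ hs ⟨0, two_pos⟩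
  exact ⟨H, h1, m, hm⟩

end Count

/-! ### The named fact, given the transversal Nullstellensatz for surfaces -/

/-- **Serre's théorème A for line cocycles on a smooth projective surface, sections form, from the
transversal Nullstellensatz in dimension `2`**: `serre_theoremA_lineCocycle_surface` holds as soon as
every pair `(E, M)` with `dim E = 2` has the transversal Nullstellensatz on chart sets. SUPERSEDED: the
fact is now discharged unconditionally by `serre_theoremA_lineCocycle_surface_holds`
(`SerreTheoremALineBundlesPencil`'s import `SerreTheoremALineBundlesProofs.lean`), so this conditional
form is kept only as a deprecated pointer; the dimension count `exists_h0_twistBundle_pos` of the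
original reduction (divisor `D = (m+1) • H`, algebraic section `1`) stays in the `Count` section above.
[cite: SerreGAGA1956, n° 16 Lemme 8 and n° 16–17] -/
@[deprecated serre_theoremA_lineCocycle_surface_holds (since := "2026-08-16")]
theorem serre_theoremA_lineCocycle_surface_of_hasTransversalNullstellensatz
    (_hN : ∀ (E : Type) [NormedAddCommGroup E] [NormedSpace ℂ E] [FiniteDimensional ℂ E] (M : Type)
      [TopologicalSpace M] [ChartedSpace E M] [IsManifold 𝓘(ℂ, E) ω M],
      Module.finrank ℂ E = 2 → HasTransversalNullstellensatz E M) :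
    serre_theoremA_lineCocycle_surface :=
  serre_theoremA_lineCocycle_surface_holds

end Literature.AlgebraicGeometry.HodgeTheory

end
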